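import Mathlib.Computability.Encoding
import Mathlib.Algebra.Polynomial.Eval.Defs
import Mathlib.Data.ENat.Lattice
import Mathlib.Data.Set.Card
import Mathlib.Algebra.Order.Floor.Defs
import Mathlib.Algebra.Order.Archimedean.Real.Basic
import Mathlib.Algebra.Order.Ring.GeomSum
import Mathlib.Data.Fintype.BigOperators
import Literature.Computability.Complexity.TimeBounds
import Literature.Computability.Complexity.BoolEncodings
import HarnessLib

-- provenance: harness21/H21/H21/Prelude/CplxMeta/UniversalMachine.lean @ 546175b (interim HEAD d8f2665); M5 mechanical rewrite
/-!
# Complexity meta: clocked universal machines and time-bounded Kolmogorov complexity `K^t`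

Trunk `CplxMeta`, concept C2 (`UniversalMachine`; outline D1). Realises the inventory notions
`universal_tm_poly_overhead` and `kolmogorov_Kt`.

Time-bounded Kolmogorov complexity `K^t(x)` (Ko 1991, Liu–Pass 2020, Hirahara 2018/2023) is the
length of a shortest program `prog` such that a fixed *efficient universal machine* `U`, run on
`(prog, 1^t)`, outputs `x` within `t` steps. All target statements of the family are robust in
the choice of `U`; accordingly we do **not** construct a universal machine but *quantify* over
all admissible ones: `UniversalMachine` is a **hypothesis structure** bundling an abstract clocked
interpreter `run : List Bool → ℕ → Option (List Bool)` (read `run prog t` as "the output of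
`U(prog, 1^t)` if `U` halts within `t` steps, `none` otherwise") together with exactly the four
properties the cited papers use:

* `run_mono` — an output, once produced, is stable under enlarging the budget;
* `polyTime` — `U` itself is efficient: `(prog, t) ↦ run prog t` is `PolyTimeComputable` on the
  input `boolPair prog (unaryEncodeNat t)` (this is Liu–Pass's one-way function candidate
  `f(prog, 1^t) = U(prog, 1^t)`);
* `sim` — universality with polynomial overhead: every Mathlib TM2 machine
  `M : Turing.TM2ComputableAux Bool Bool` has a code `e` and an overhead polynomial `p` with
  `M.OutputsWithin w y t → run (boolPair e w) (p.eval t) = some y`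
  (Hennie–Stearns 1966; Arora–Barak Thm 1.9);
* `print` — for every `ε > 0`, all long enough `x` have a "print `x`" program of length
  `≤ |x| + c` running in `⌈(1+ε)|x|⌉` steps (Liu–Pass's standing convention giving
  `K^t(x) ≤ |x| + c` whenever `t(n) ≥ (1+ε)n`).

Non-vacuity is the known theorem `UniversalMachine.nonempty` (`sorry`; efficient universal
simulation transported to TM2). `run` is deliberately **not** tied to the step count of a
concrete `Turing.FinTM2`: doing so would re-import the `haltList` halting conventions of
`Turing.TM2OutputsInTime` (see `Literature.Prelude.CplxCore.TimeBounds`) into every `K^t` bound.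

Then, as functions of `U`:

* `U.ktAt t x : ℕ∞` — `K^t(x)` at absolute time budget `t` (`⊤` if no program prints `x` in
  time `t`; `ℕ∞`-valued `⨅`, avoiding the `sInf ∅ = 0` junk value);
* `U.kt t x` — `K^t(x)` for a time *bound* `t : ℕ → ℕ`, i.e. `U.ktAt (t |x|) x`;
* `U.MINKT` — Ko's language `{⟨x, 1^t, 1^s⟩ | K^t(x) ≤ s}`;
* `U.MKtimeP t s` — Liu–Pass/Hirahara's `MK^tP[s] = {x | K^t(x) ≤ s(|x|)}`;
* `U.eval prog : Part (List Bool)` — the untimed semantics.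

## Mathlib search

Mathlib has the *untimed* universal partial recursive function `Nat.Partrec.Code.eval` and
`Turing.TM2ComputableInPolyTime`, but no clocked/efficient universal Turing machine and no
Kolmogorov complexity of any kind (`rg -i kolmogorov` only hits probability theory). Everything
below is new; the time-bounded computability layer is G01's `Literature.Computability.Complexity.PolyTimeComputable` /
`Turing.TM2ComputableAux.OutputsWithin`, pairing is G01's `Literature.Computability.Complexity.boolPair`, budgets are
encoded with Mathlib's `Computability.unaryEncodeNat`.

## Omitted variants

Allender et al.'s `KT` complexity, Levin's `Kt(x) = min (|p| + log t)` (whose decision problem is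
the literature's `MKtP` — hence our name `MKtimeP` for Liu–Pass's `MK^tP`), prefix-free `K`,
and conditional/oracle versions are **not** defined: no target statement needs them.

## References

* K.-I. Ko, *On the complexity of learning minimum time-bounded Turing machines*, SIAM J. Comput.
  20 (1991) — `MINKT`.
* Y. Liu, R. Pass, *On one-way functions and Kolmogorov complexity*, FOCS 2020, §2.2 (universal
  machine conventions, `K^t`, `MK^tP[s]`), Thm 1.1.
* S. Hirahara, *Non-black-box worst-case to average-case reductions within NP*, FOCS 2018;
  *Capturing one-way functions via NP-hardness of meta-complexity*, STOC 2023.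
* F. C. Hennie, R. E. Stearns, *Two-tape simulation of multitape Turing machines*, J. ACM 13
  (1966); S. Arora, B. Barak, *Computational Complexity: A Modern Approach*, CUP 2009, Thm 1.9.
* M. Li, P. Vitányi, *An Introduction to Kolmogorov Complexity and Its Applications*, 3rd ed.,
  §7.1 (resource-bounded complexity).
-/

namespace Literature.Computability.MetaComplexity

open _root_.Computability Complexity

/-- A **clocked efficient universal machine** over the alphabet `Bool`, as a hypothesis
structure (outline D1). `run prog t` abstracts "the output of `U(prog, 1^t)`, if `U` halts within
`t` steps" and is *not* tied to the step count of a concrete TM2 machine; the four fields are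
exactly the properties of `U` used by Liu–Pass (FOCS 2020, §2.2) and Hirahara (FOCS 2018,
STOC 2023): monotonicity in the budget, efficiency of `U` itself, universality with polynomial
overhead (Hennie–Stearns 1966; Arora–Barak 2009, Thm 1.9), and cheap printing programs.
Every `K^t` statement of the library quantifies `∀ U : UniversalMachine`. [cite: FOCS2020, §2.2] -/
structure UniversalMachine where
  /-- `run prog t = some y` means: the universal machine on program `prog` with time budget `t`
  (input `(prog, 1^t)`) halts within the budget and outputs `y`; `none` means "no output within
  `t` steps". [Liu–Pass 2020, §2.2] -/
  run : List Bool → ℕ → Option (List Bool)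
  /-- Outputs are stable under enlarging the time budget. [Liu–Pass 2020, §2.2] -/
  run_mono : ∀ {prog : List Bool} {t t' : ℕ} {y : List Bool},
    t ≤ t' → run prog t = some y → run prog t' = some y
  /-- The universal machine is itself efficient: `(prog, t) ↦ run prog t` is polynomial-time
  computable on the input `boolPair prog (unaryEncodeNat t)` (budget in unary), the output
  `Option (List Bool)` being encoded by `(encodingList Bool).optionBool`. This is the function
  `f(prog, 1^t) = U(prog, 1^t)` of Liu–Pass's one-way-function candidate.
  [Liu–Pass 2020, §2.2 and proof of Thm 1.1; Arora–Barak 2009, Thm 1.9] -/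
  polyTime : PolyTimeComputable (fun q : List Bool × ℕ => boolPair q.1 (unaryEncodeNat q.2))
    ((encodingList Bool).optionBool).encode (Function.uncurry run)
  /-- Universality with polynomial overhead: every TM2 machine `M` with Boolean input/output
  alphabets has a code `e` and an overhead polynomial `p` such that whenever `M` outputs `y` on
  `w` within `t` steps, the universal machine outputs `y` on the program `boolPair e w` within
  `p.eval t` steps. The simulating program is `boolPair e w`, of length `|w| + 2|e| + 2` by
  `Literature.Computability.Complexity.length_boolPair`; this additive constant `2|e| + 2` is what every `K^t` upper
  bound uses. [Hennie–Stearns 1966; Arora–Barak 2009, Thm 1.9; Liu–Pass 2020, §2.2] -/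
  sim : ∀ M : Turing.TM2ComputableAux Bool Bool, ∃ (e : List Bool) (p : Polynomial ℕ),
    ∀ (w y : List Bool) (t : ℕ), M.OutputsWithin w y t → run (boolPair e w) (p.eval t) = some y
  /-- Cheap printing: for every `ε > 0` there are constants `c, n₀` such that every string `x`
  with `|x| ≥ n₀` is printed by some program of length `≤ |x| + c` within `⌈(1 + ε)|x|⌉` steps.
  This is Liu–Pass's standing convention on `U` making `K^t(x) ≤ |x| + c` for all time bounds
  `t(n) ≥ (1+ε)n`. [Liu–Pass 2020, §2.2 (Fact 2.2)] -/
  print : ∀ ε : ℝ, 0 < ε → ∃ c n₀ : ℕ, ∀ x : List Bool, n₀ ≤ x.length →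
    ∃ prog : List Bool, prog.length ≤ x.length + c ∧ run prog ⌈(1 + ε) * x.length⌉₊ = some x

namespace UniversalMachine

variable (U : UniversalMachine)

/-- `U.ktAt t x = K^t(x)` at the *absolute* time budget `t : ℕ`: the length of a shortest
program `prog` with `U.run prog t = some x`, as an element of `ℕ∞` (`⊤` iff no program prints
`x` within `t` steps). [Liu–Pass 2020, §2.2; Ko 1991; Li–Vitányi, §7.1] [cite: LiuPass2020, §2.2] -/
noncomputable def ktAt (t : ℕ) (x : List Bool) : ℕ∞ :=
  ⨅ (prog : List Bool) (_ : U.run prog t = some x), (prog.length : ℕ∞)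

/-- `U.kt t x = K^t(x)` for a time *bound* `t : ℕ → ℕ`: `K^{t(|x|)}(x)`, i.e.
`U.ktAt (t x.length) x`. This is the time-bounded Kolmogorov complexity `K^t` of
Ko/Liu–Pass/Hirahara, **not** Levin's `Kt(x) = min (|p| + log t)`. [Liu–Pass 2020, §2.2] [cite: LiuPass2020, §2.2] -/
noncomputable def kt (t : ℕ → ℕ) (x : List Bool) : ℕ∞ :=
  U.ktAt (t x.length) x

/-- Ko's language `MINKT = {⟨x, 1^t, 1^s⟩ | K^t(x) ≤ s}`, encoded as
`boolPair x (boolPair (unaryEncodeNat t) (unaryEncodeNat s))`. [Ko 1991; Hirahara FOCS 2018,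
§1] [cite: Ko1991] -/
def MINKT : Language Bool :=
  {w | ∃ (x : List Bool) (t s : ℕ),
    w = boolPair x (boolPair (unaryEncodeNat t) (unaryEncodeNat s)) ∧ U.ktAt t x ≤ s}

/-- Liu–Pass/Hirahara's `MK^tP[s] = {x | K^t(x) ≤ s(|x|)}` for a time bound `t` and a size
threshold `s`, both functions of the input length. Named `MKtimeP` because `MKtP` denotes the
decision problem for *Levin's* `Kt` (Allender–Buhrman–Koucký–van Melkebeek–Ronneburger 2006) in
the literature, which is **not** this language. [Liu–Pass 2020, §2.2; Hirahara STOC 2023] [cite: LiuPass2020, §2.2] -/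
def MKtimeP (t s : ℕ → ℕ) : Language Bool :=
  {x | U.kt t x ≤ s x.length}

/-- Membership in `MKtimeP` unfolds definitionally. [Liu–Pass 2020, §2.2] [cite: LiuPass2020, §2.2] -/
theorem mem_MKtimeP_iff {t s : ℕ → ℕ} {x : List Bool} :
    x ∈ U.MKtimeP t s ↔ U.kt t x ≤ s x.length :=
  Iff.rfl

/-- Membership in `MINKT` of a well-formed triple `⟨x, 1^t, 1^s⟩` is `K^t(x) ≤ s`
(by injectivity of `boolPair` and `unaryEncodeNat`). [Ko 1991] [cite: Ko1991] -/
theorem boolPair_mem_MINKT_iff {x : List Bool} {t s : ℕ} :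
    boolPair x (boolPair (unaryEncodeNat t) (unaryEncodeNat s)) ∈ U.MINKT ↔ U.ktAt t x ≤ s := by
  constructor
  · rintro ⟨x', t', s', h, hk⟩
    have h1 := boolPair_injective (a₁ := (x, _)) (a₂ := (x', _)) h
    simp only [Prod.mk.injEq] at h1
    obtain ⟨rfl, h2⟩ := h1
    have h3 := boolPair_injective (a₁ := (unaryEncodeNat t, _)) (a₂ := (unaryEncodeNat t', _)) h2
    simp only [Prod.mk.injEq] at h3
    obtain ⟨ht, hs⟩ := h3
    have ht' : t = t' := by simpa using congr_arg unaryDecodeNat ht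
    have hs' : s = s' := by simpa using congr_arg unaryDecodeNat hs
    subst ht' hs'
    exact hk
  · exact fun h => ⟨x, t, s, rfl, h⟩

/-- The untimed semantics of `U`: `U.eval prog` is defined iff `U.run prog t` produces an
output for some budget `t`, and then returns the output at the least such budget (equal to the
output at every larger budget by `run_mono`). Links `K^t` to plain Kolmogorov complexity
(`Literature.CplxMeta.Kolmogorov`). [Li–Vitányi, §7.1] [folklore] -/
def eval (prog : List Bool) : Part (List Bool) :=
  ⟨∃ t : ℕ, ((U.run prog t).isSome : Prop),
    fun h => (U.run prog (Nat.find h)).get (Nat.find_spec h)⟩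

/-- If `U.run prog t = some y` then the untimed semantics is `y`. [Li–Vitányi, §7.1] [folklore] -/
theorem mem_eval_of_run_eq_some {prog y : List Bool} {t : ℕ} (h : U.run prog t = some y) :
    y ∈ U.eval prog := by
  have hex : ∃ t : ℕ, ((U.run prog t).isSome : Prop) := ⟨t, by simp [h]⟩
  refine ⟨hex, ?_⟩
  have hle : Nat.find hex ≤ t := Nat.find_min' hex (by simp [h])
  obtain ⟨y', hy'⟩ := Option.isSome_iff_exists.mp (Nat.find_spec hex)
  have := U.run_mono hle hy'
  rw [h] at this
  cases this
  simp [eval, hy']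

/-! ### Basic API -/

/-- `K^t` is antitone in the budget: more time never hurts. Real proof from `run_mono`.
[Liu–Pass 2020, §2.2] [cite: LiuPass2020, §2.2] -/
theorem ktAt_anti {t t' : ℕ} (h : t ≤ t') (x : List Bool) : U.ktAt t' x ≤ U.ktAt t x :=
  le_iInf₂ fun prog hprog => iInf₂_le prog (U.run_mono h hprog)

/-- Any program printing `x` within `t` steps bounds `K^t(x)`. [Liu–Pass 2020, §2.2] [cite: LiuPass2020, §2.2] -/
theorem ktAt_le_length {prog x : List Bool} {t : ℕ} (h : U.run prog t = some x) :
    U.ktAt t x ≤ prog.length :=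
  iInf₂_le prog h

/-- `K^t(x) = ⊤` iff no program prints `x` within `t` steps. [Liu–Pass 2020, §2.2] [cite: LiuPass2020, §2.2] -/
theorem ktAt_eq_top_iff {t : ℕ} {x : List Bool} :
    U.ktAt t x = ⊤ ↔ ∀ prog, U.run prog t ≠ some x := by
  simp [ktAt, iInf_eq_top]

/-- `K^t(x) < ⊤` iff some program prints `x` within `t` steps. [Liu–Pass 2020, §2.2] [cite: LiuPass2020, §2.2] -/
theorem ktAt_lt_top_iff {t : ℕ} {x : List Bool} :
    U.ktAt t x < ⊤ ↔ ∃ prog, U.run prog t = some x := by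
  rw [lt_top_iff_ne_top, Ne, ktAt_eq_top_iff]
  push Not
  rfl

/-- If `K^t(x) < m` then some program of length `< m` prints `x` within `t` steps (the infimum
is attained on a nonempty set of naturals). [Liu–Pass 2020, §2.2] [cite: LiuPass2020, §2.2] -/
theorem exists_run_eq_of_ktAt_lt {t : ℕ} {x : List Bool} {m : ℕ∞} (h : U.ktAt t x < m) :
    ∃ prog, U.run prog t = some x ∧ (prog.length : ℕ∞) < m := by
  obtain ⟨prog, hprog⟩ := iInf_lt_iff.mp h
  obtain ⟨hrun, hlt⟩ := iInf_lt_iff.mp hprog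
  exact ⟨prog, hrun, hlt⟩

/-- The basic upper bound `K^t(x) ≤ |x| + c` for `t ≥ (1+ε)|x|` and `|x| ≥ n₀`. Real proof
from `print` and `run_mono`. [Liu–Pass 2020, §2.2 (Fact 2.2)] [cite: LiuPass2020, §2.2 (Fact 2.2] -/
theorem kt_le_length_add {ε : ℝ} (hε : 0 < ε) :
    ∃ c n₀ : ℕ, ∀ x : List Bool, n₀ ≤ x.length →
      ∀ t : ℕ, ⌈(1 + ε) * x.length⌉₊ ≤ t → U.ktAt t x ≤ x.length + c := by
  obtain ⟨c, n₀, h⟩ := U.print ε hε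
  refine ⟨c, n₀, fun x hx t ht => ?_⟩
  obtain ⟨prog, hlen, hrun⟩ := h x hx
  calc U.ktAt t x ≤ prog.length := U.ktAt_le_length (U.run_mono ht hrun)
    _ ≤ x.length + c := by exact_mod_cast hlen

/-- Under Liu–Pass's convention `t(n) ≥ (1+ε)n`, `K^t(x)` is finite for all long enough `x`.
[Liu–Pass 2020, §2.2 (Fact 2.2)] [cite: LiuPass2020, §2.2 (Fact 2.2] -/
theorem kt_lt_top_of_le {ε : ℝ} (hε : 0 < ε) :
    ∃ n₀ : ℕ, ∀ x : List Bool, n₀ ≤ x.length →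
      ∀ t : ℕ, ⌈(1 + ε) * x.length⌉₊ ≤ t → U.ktAt t x < ⊤ := by
  obtain ⟨c, n₀, h⟩ := U.kt_le_length_add hε
  refine ⟨n₀, fun x hx t ht => (h x hx t ht).trans_lt ?_⟩
  exact_mod_cast ENat.coe_lt_top (x.length + c)

/-- The simulation upper bound: if `M` outputs `y` on `w` within `t` steps then, with `e, p` the
code and overhead of `M` from `sim`, `K^{p(t)}(y) ≤ |w| + 2|e| + 2` (uniformly in `w, y, t`).
This is the form in which universality enters every `K^t` upper bound.
[Liu–Pass 2020, §2.2; Arora–Barak 2009, Thm 1.9] [cite: LiuPass2020, §2.2] -/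
theorem exists_ktAt_le_of_outputsWithin (M : Turing.TM2ComputableAux Bool Bool) :
    ∃ (e : List Bool) (p : Polynomial ℕ), ∀ (w y : List Bool) (t : ℕ),
      M.OutputsWithin w y t → U.ktAt (p.eval t) y ≤ w.length + (2 * e.length + 2) := by
  obtain ⟨e, p, h⟩ := U.sim M
  refine ⟨e, p, fun w y t hw => (U.ktAt_le_length (h w y t hw)).trans_eq ?_⟩
  rw [length_boolPair]
  push_cast
  ring

/-- Counting: fewer than `2 ^ m` strings have `K^t`-complexity `< m` (there are only `2^m - 1`
programs of length `< m`, and a program prints at most one string). [Li–Vitányi, Thm 2.2.1;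
Liu–Pass 2020, §2.2] [cite: LiuPass2020, §2.2] -/
theorem ncard_setOf_ktAt_lt (t m : ℕ) : {x | U.ktAt t x < m}.ncard < 2 ^ m := by
  set S : Set (List Bool) := {x | U.ktAt t x < m}
  have hS : ∀ x : S, ∃ prog, U.run prog t = some x.1 ∧ prog.length < m := fun x => by
    obtain ⟨prog, h1, h2⟩ := U.exists_run_eq_of_ktAt_lt x.2
    exact ⟨prog, h1, by exact_mod_cast h2⟩
  choose f hf hfl using hS
  let g : S → Σ k : Fin m, List.Vector Bool k := fun x => ⟨⟨(f x).length, hfl x⟩, ⟨f x, rfl⟩⟩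
  have hg : Function.Injective g := by
    intro x x' h
    have h' : f x = f x' :=
      congr_arg (fun s : Σ k : Fin m, List.Vector Bool k => s.2.toList) h
    have := (hf x).symm.trans (h' ▸ hf x')
    exact Subtype.ext (Option.some.inj this)
  calc S.ncard = Nat.card S := (Nat.card_coe_set_eq S).symm
    _ ≤ Nat.card (Σ k : Fin m, List.Vector Bool k) := Nat.card_le_card_of_injective g hg
    _ = ∑ k ∈ Finset.range m, 2 ^ k := by
      rw [Nat.card_eq_fintype_card, Fintype.card_sigma]
      simp only [card_vector, Fintype.card_bool]
      exact Fin.sum_univ_eq_sum_range (fun k => 2 ^ k) m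
    _ < 2 ^ m := Nat.geomSum_lt le_rfl fun k hk => Finset.mem_range.mp hk

/-- The universal machine is polynomial-time (projection of the `polyTime` field).
[Liu–Pass 2020, §2.2] [cite: LiuPass2020, §2.2] -/
theorem polyTimeComputable_run :
    PolyTimeComputable (fun q : List Bool × ℕ => boolPair q.1 (unaryEncodeNat q.2))
      ((encodingList Bool).optionBool).encode (Function.uncurry U.run) :=
  U.polyTime

/-- **Existence of an efficient universal machine** (non-vacuity of the hypothesis structure):
there is a TM2-computable clocked interpreter simulating every TM2 machine with polynomial
(indeed `O(t log t)`) overhead, itself running in polynomial time, with linear-time printing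
programs. Known theorem: Hennie–Stearns 1966; Arora–Barak 2009, Thm 1.9 (transported to
Mathlib's TM2 model). [cite: HennieStearns1966] -/
def nonempty : Prop :=
  Nonempty UniversalMachine

end UniversalMachine

end Literature.Computability.MetaComplexity
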